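import Summits.QuantumFields.YangMills.Theorems.BalabanUVNodesN15DerivDefectMajorant

/-!
# Route «BalabanUVNodes» (K4 «SpineRates»), node N15 = NE2, BACKGROUND LAYER — first missing estimate, part 3/3: THE BLOCK-LINE DATA OF
# `ℤ^d`, OF THE UNIT CIRCLE AND OF THE UNIT TORUS; SHARPNESS OF THE POINTWISE SIZE `M − 1`

Cell `pub-ymgap`, seat `pub-ymgap-dag-n15-b` (D-0062; `bears_on: R4∕N15`; `--supports stmt-QuantumFields-19351`).  Parts 1–2
(`BalabanUVNodesN15DerivDefect`, `…Majorant`) are stated over abstract `LineData X X′` (record `pub-balaban/t4/T4-EST-U1a.md` §16 item S5).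
THIS FILE inhabits the data:
* §6a `zdLine M hM μ` — `ℤ^d` with the prelude's blocks `QuantumLattice.blockMap M = ⌊·∕M⌋` (coordinatewise), direction `μ`, unit shifts
  `· + e_μ` on both lattices, depth `x_μ mod M`: the setting of `T4EtaRateCoeffDefect` §4 (`InBlockBondBound`); the exact defect formula of
  part 1 then reads `𝔇(∇′_{η′}, ∇_η)(f)(x) = (M·1_{x_μ ≡ M−1 (M)} − 1)·η⁻¹(f(⌊x∕M⌋ + e_μ) − f(⌊x∕M⌋))` (`idef_fdiffN_zd_apply`) — item S5's «EXACT
  formula on the ℤ^d blocks of §4», hypothesis-free;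
* §6b `circLine n M hM` — the unit CIRCLE with `n` coarse points (`ZMod n`, shift `+1`) and `Mn` fine points presented as (coarse point,
  position in its block), fine shift = the odometer successor (`circShift`, a bijection): King's pairing «x′ ∈ B^n(x)» ([King1986] p. 664) in
  `d = 1`; finite, so part 2's majorants apply to it;
* §6c `torusLine n M hM μ` — its `d`-fold product, the unit TORUS with `n^d` coarse and `(Mn)^d` fine sites, line data in each direction;
* §6d `exists_const_hasMaj_ofBlocks` ∕ `exists_apriori_weighted_ofBlocks`: on FINITE lattices every linear map has a constant (and a source-weighted)
  majorant between the sharp cube norms — the a priori binder `hap` of the Neumann bookkeeping is automatic;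
* §7 SHARPNESS: on the circle with ONE coarse point and `M = 2` fine points the pointwise majorant `diagK (M − 1) = diagK 1` of `M_χ ∘ pull π`
  holds (`toy_hasMaj`, an instance of part 2) and `diagK (1∕2)` FAILS (`toy_not_hasMaj_half`): the η-defect of the derivative is of ORDER ONE
  pointwise — smallness is exactly part 2's composite statement, as the record's HONEST LIMIT (b) says.

HONEST FRAMING.  [folklore] plumbing and one must-fail witness; nothing of [B9] asserted; NE2⁺ NOT PRINTED, NOT proved; count-neutral; one
finite T⁴ at fixed ε — NOT infinite volume, NOT OS on ℝ⁴, NOT a mass gap, NOT Clay.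
-/

noncomputable section

namespace Summit.QuantumFields.YangMills.BalabanUVNodes.N15.DerivDefect

open Literature.MathematicalPhysics.QuantumFieldTheory.Balaban1983to89
open Literature.MathematicalPhysics.QuantumFieldTheory.Balaban1983to89.B11SectG (BlockNorm HasMaj hasMaj_comp)
open Literature.MathematicalPhysics.QuantumFieldTheory.Balaban1983to89.T4EtaRateDefect (idef)
open Literature.MathematicalPhysics.QuantumFieldTheory.Balaban1983to89.T4EtaRateCoeffDefect (pull pull_apply diagK
  diagK_same diagK_ne diagK_nonneg loc_fine_mul_pull_le)
open Literature.MathematicalPhysics.QuantumFieldTheory.Balaban1983to89.B11AxialTransport190 (abs_le_loc_ofBlocks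
  loc_ofBlocks_le)
open Literature.MathematicalPhysics.QuantumFieldTheory.Balaban1983to89.B6Prop26Gluing (mulOp mulOp_apply)
open Literature.MathematicalPhysics.QuantumLattice (blockMap)

/-! ## §6 Instances: `ℤ^d` in direction `μ`; the unit circle; the unit torus -/

section Zd

variable {d : ℕ}

/-- Floor division and remainder of `a + 1` by `M > 0`, below the face. [folklore] -/
theorem ediv_emod_succ_of_lt {M : ℕ} (hM : 0 < M) {a : ℤ} (h : a % (M : ℤ) + 1 < M) :
    (a + 1) / (M : ℤ) = a / (M : ℤ) ∧ (a + 1) % (M : ℤ) = a % (M : ℤ) + 1 := by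
  have hMz : (M : ℤ) ≠ 0 := by exact_mod_cast hM.ne'
  have hr0 : 0 ≤ a % (M : ℤ) := Int.emod_nonneg a hMz
  have hdecomp : a + 1 = (a % (M : ℤ) + 1) + (M : ℤ) * (a / (M : ℤ)) := by
    have := Int.emod_add_mul_ediv a (M : ℤ)
    linarith
  constructor
  · rw [hdecomp, Int.add_mul_ediv_left _ _ hMz, Int.ediv_eq_zero_of_lt (by linarith) h, zero_add]
  · rw [hdecomp, Int.add_mul_emod_self_left, Int.emod_eq_of_lt (by linarith) h]

/-- Floor division and remainder of `a + 1` by `M > 0`, at the face. [folklore] -/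
theorem ediv_emod_succ_of_eq {M : ℕ} (hM : 0 < M) {a : ℤ} (h : a % (M : ℤ) + 1 = M) :
    (a + 1) / (M : ℤ) = a / (M : ℤ) + 1 ∧ (a + 1) % (M : ℤ) = 0 := by
  have hMz : (M : ℤ) ≠ 0 := by exact_mod_cast hM.ne'
  have hdecomp : a + 1 = 0 + (M : ℤ) * (a / (M : ℤ) + 1) := by
    have := Int.emod_add_mul_ediv a (M : ℤ)
    linarith
  constructor
  · rw [hdecomp, Int.add_mul_ediv_left _ _ hMz, Int.zero_ediv, zero_add]
  · rw [hdecomp, Int.add_mul_emod_self_left, Int.zero_emod]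

/-- The depth `x_μ mod M` as a natural number, and its cast. [folklore] -/
theorem toNat_emod_cast {M : ℕ} (hM : 0 < M) (a : ℤ) : ((a % (M : ℤ)).toNat : ℤ) = a % (M : ℤ) :=
  Int.toNat_of_nonneg (Int.emod_nonneg a (by exact_mod_cast hM.ne'))

/-- BLOCK-LINE DATA ON `ℤ^d`: blocks of side `M ≥ 1` (prelude `blockMap M = ⌊·/M⌋` coordinatewise), direction `μ`, the
unit shifts `· + e_μ` on both lattices, depth `x_μ mod M` — the setting of `T4EtaRateCoeffDefect` §4
(`InBlockBondBound`). [folklore] -/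
def zdLine (M : ℕ) (hM : 0 < M) (μ : Fin d) : LineData (Fin d → ℤ) (Fin d → ℤ) where
  M := M
  M_pos := hM
  π := blockMap M
  s := fun x => x + Pi.single μ 1
  s' := Equiv.addRight (Pi.single μ (1 : ℤ))
  dep := fun x => (x μ % (M : ℤ)).toNat
  dep_lt := fun x => by
    have h := Int.emod_lt_of_pos (x μ) (show (0 : ℤ) < M by exact_mod_cast hM)
    have h0 := Int.emod_nonneg (x μ) (show (M : ℤ) ≠ 0 by exact_mod_cast hM.ne')
    omega
  π_succ_of_lt := fun x h => by
    have hc : x μ % (M : ℤ) + 1 < M := by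
      have := toNat_emod_cast hM (x μ); omega
    funext i
    show ((x + Pi.single μ (1 : ℤ) : Fin d → ℤ) i) / (M : ℤ) = x i / (M : ℤ)
    by_cases hi : i = μ
    · subst hi
      rw [Pi.add_apply, Pi.single_eq_same]
      exact (ediv_emod_succ_of_lt hM hc).1
    · rw [Pi.add_apply, Pi.single_eq_of_ne hi, add_zero]
  dep_succ_of_lt := fun x h => by
    have hc : x μ % (M : ℤ) + 1 < M := by
      have := toNat_emod_cast hM (x μ); omega
    show (((x + Pi.single μ (1 : ℤ) : Fin d → ℤ) μ) % (M : ℤ)).toNat = (x μ % (M : ℤ)).toNat + 1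
    rw [Pi.add_apply, Pi.single_eq_same, (ediv_emod_succ_of_lt hM hc).2]
    have h0 := Int.emod_nonneg (x μ) (show (M : ℤ) ≠ 0 by exact_mod_cast hM.ne')
    omega
  π_succ_of_eq := fun x h => by
    have hc : x μ % (M : ℤ) + 1 = M := by
      have := toNat_emod_cast hM (x μ); omega
    funext i
    show ((x + Pi.single μ (1 : ℤ) : Fin d → ℤ) i) / (M : ℤ) = (blockMap M x + Pi.single μ (1 : ℤ) : Fin d → ℤ) i
    by_cases hi : i = μ
    · subst hi
      rw [Pi.add_apply, Pi.single_eq_same, Pi.add_apply, Pi.single_eq_same]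
      exact (ediv_emod_succ_of_eq hM hc).1
    · rw [Pi.add_apply, Pi.single_eq_of_ne hi, add_zero, Pi.add_apply, Pi.single_eq_of_ne hi, add_zero]
      rfl
  dep_succ_of_eq := fun x h => by
    have hc : x μ % (M : ℤ) + 1 = M := by
      have := toNat_emod_cast hM (x μ); omega
    show (((x + Pi.single μ (1 : ℤ) : Fin d → ℤ) μ) % (M : ℤ)).toNat = 0
    rw [Pi.add_apply, Pi.single_eq_same, (ediv_emod_succ_of_eq hM hc).2]
    rfl

/-- On `ℤ^d` the block projection of the line data IS the prelude's `blockMap`. [folklore] -/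
@[simp] theorem zdLine_π (M : ℕ) (hM : 0 < M) (μ : Fin d) : (zdLine M hM μ).π = blockMap (d := d) M := rfl

/-- On `ℤ^d` the fine forward difference of the line data is `f(x + e_μ) − f(x)`. [folklore] -/
theorem fdiff_zdLine_apply (M : ℕ) (hM : 0 < M) (μ : Fin d) (f : (Fin d → ℤ) → ℝ) (x : Fin d → ℤ) :
    fdiff (zdLine M hM μ).s' f x = f (x + Pi.single μ 1) - f x := rfl

/-- THE EXACT DEFECT FORMULA ON `ℤ^d` (S5 «EXACT formula first»): the two-spacing defect of the flat difference quotients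
in direction `μ` under the piecewise-constant pull-back along `blockMap M` is
`(Mꞏ1_{x_μ ≡ M−1 (mod M)} − 1)ꞏ(∇_η f)(⌊x/M⌋)`. [folklore] -/
theorem idef_fdiffN_zd_apply (M : ℕ) (hM : 0 < M) (μ : Fin d) {η η' : ℝ} (hη' : η' ≠ 0) (hMη : (M : ℝ) * η' = η)
    (f : (Fin d → ℤ) → ℝ) (x : Fin d → ℤ) :
    idef (pull (blockMap (d := d) M)) (pull (blockMap (d := d) M)) (fdiffN η' (zdLine M hM μ).s')
        (fdiffN η (zdLine M hM μ).s) f x =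
      (zdLine M hM μ).chi x * (η⁻¹ * (f (blockMap M x + Pi.single μ 1) - f (blockMap M x))) :=
  idef_fdiffN_apply (zdLine M hM μ) hη' hMη f x

end Zd

section Circle

variable (n M : ℕ) (hM : 0 < M)

/-- The fine successor on the unit circle with `n` coarse and `Mn` fine points, presented as (coarse point, position in
its block): one step inside the block, or into the next block at position `0`. [folklore] -/
def circSucc (p : ZMod n × Fin M) : ZMod n × Fin M :=
  if h : p.2.val + 1 < M then (p.1, ⟨p.2.val + 1, h⟩) else (p.1 + 1, ⟨0, hM⟩)

/-- Its inverse. [folklore] -/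
def circPred (p : ZMod n × Fin M) : ZMod n × Fin M :=
  if p.2.val = 0 then (p.1 - 1, ⟨M - 1, Nat.sub_lt hM Nat.one_pos⟩) else (p.1, ⟨p.2.val - 1, by omega⟩)

/-- `circPred` is a left inverse of `circSucc`. [folklore] -/
theorem circPred_circSucc (p : ZMod n × Fin M) : circPred n M hM (circSucc n M hM p) = p := by
  obtain ⟨y, t⟩ := p
  by_cases h : t.val + 1 < M
  · rw [show circSucc n M hM (y, t) = (y, ⟨t.val + 1, h⟩) by simp [circSucc, h]]
    have hne : ¬ ((⟨t.val + 1, h⟩ : Fin M).val = 0) := by simp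
    simp only [circPred, hne, ↓reduceIte, Prod.mk.injEq, true_and]
    ext
    simp
  · rw [show circSucc n M hM (y, t) = (y + 1, ⟨0, hM⟩) by simp [circSucc, h]]
    simp only [circPred, ↓reduceIte, add_sub_cancel_right, Prod.mk.injEq, true_and]
    ext
    simp only
    omega

/-- `circPred` is a right inverse of `circSucc`. [folklore] -/
theorem circSucc_circPred (p : ZMod n × Fin M) : circSucc n M hM (circPred n M hM p) = p := by
  obtain ⟨y, t⟩ := p
  by_cases h : t.val = 0
  · rw [show circPred n M hM (y, t) = (y - 1, ⟨M - 1, Nat.sub_lt hM Nat.one_pos⟩) by simp [circPred, h]]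
    have hn : ¬ ((⟨M - 1, Nat.sub_lt hM Nat.one_pos⟩ : Fin M).val + 1 < M) := by
      show ¬ (M - 1 + 1 < M)
      omega
    simp only [circSucc, hn, ↓reduceDIte, sub_add_cancel, Prod.mk.injEq, true_and]
    ext
    exact h.symm
  · rw [show circPred n M hM (y, t) = (y, ⟨t.val - 1, by omega⟩) by simp [circPred, h]]
    have hy : ((⟨t.val - 1, by omega⟩ : Fin M).val + 1 < M) := by simp; omega
    simp only [circSucc, hy, ↓reduceDIte, Prod.mk.injEq, true_and]
    ext
    simp only
    omega

/-- The fine shift of the circle as a bijection. [folklore] -/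
def circShift : (ZMod n × Fin M) ≃ (ZMod n × Fin M) where
  toFun := circSucc n M hM
  invFun := circPred n M hM
  left_inv := circPred_circSucc n M hM
  right_inv := circSucc_circPred n M hM

/-- BLOCK-LINE DATA ON THE UNIT CIRCLE: `n` coarse points (`ZMod n`, shift `+1`), `Mn` fine points presented as
(coarse point, position), `π` = the coarse point, `dep` = the position — King's pairing «x′ ∈ B^n(x)» in `d = 1`.
[cite: King1986, p.664 (pairing convention)] -/
def circLine : LineData (ZMod n) (ZMod n × Fin M) where
  M := M
  M_pos := hM
  π := Prod.fst
  s := fun y => y + 1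
  s' := circShift n M hM
  dep := fun p => p.2.val
  dep_lt := fun p => p.2.isLt
  π_succ_of_lt := fun p h => by
    show (circSucc n M hM p).1 = p.1
    simp [circSucc, h]
  dep_succ_of_lt := fun p h => by
    show (circSucc n M hM p).2.val = p.2.val + 1
    simp [circSucc, h]
  π_succ_of_eq := fun p h => by
    show (circSucc n M hM p).1 = p.1 + 1
    simp [circSucc, h]
  dep_succ_of_eq := fun p h => by
    show (circSucc n M hM p).2.val = 0
    simp [circSucc, h]

end Circle

section Torus

variable {d : ℕ} (n M : ℕ) (hM : 0 < M) (μ : Fin d)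

/-- The fine shift of the `d`-dimensional unit torus in direction `μ`: the circle shift in coordinate `μ`. [folklore] -/
def torusShift : (Fin d → ZMod n × Fin M) ≃ (Fin d → ZMod n × Fin M) where
  toFun := fun x => Function.update x μ (circSucc n M hM (x μ))
  invFun := fun x => Function.update x μ (circPred n M hM (x μ))
  left_inv := fun x => by
    simp only [Function.update_self, circPred_circSucc, Function.update_idem, Function.update_eq_self]
  right_inv := fun x => by
    simp only [Function.update_self, circSucc_circPred, Function.update_idem, Function.update_eq_self]

/-- BLOCK-LINE DATA ON THE UNIT TORUS `(coarse point, position)^d` in direction `μ`: `n^d` coarse sites, `(Mn)^d` fine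
sites, `π` coordinatewise the coarse point, `dep` = the position of coordinate `μ`. [folklore] -/
def torusLine : LineData (Fin d → ZMod n) (Fin d → ZMod n × Fin M) where
  M := M
  M_pos := hM
  π := fun x i => (x i).1
  s := fun y => Function.update y μ (y μ + 1)
  s' := torusShift n M hM μ
  dep := fun x => (x μ).2.val
  dep_lt := fun x => (x μ).2.isLt
  π_succ_of_lt := fun x h => by
    funext i
    show (Function.update x μ (circSucc n M hM (x μ)) i).1 = (x i).1
    by_cases hi : i = μ
    · subst hi
      rw [Function.update_self]
      simp [circSucc, h]
    · rw [Function.update_of_ne hi]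
  dep_succ_of_lt := fun x h => by
    show (Function.update x μ (circSucc n M hM (x μ)) μ).2.val = (x μ).2.val + 1
    rw [Function.update_self]
    simp [circSucc, h]
  π_succ_of_eq := fun x h => by
    funext i
    show (Function.update x μ (circSucc n M hM (x μ)) i).1 = Function.update (fun i => (x i).1) μ ((x μ).1 + 1) i
    by_cases hi : i = μ
    · subst hi
      rw [Function.update_self, Function.update_self]
      simp [circSucc, h]
    · rw [Function.update_of_ne hi, Function.update_of_ne hi]
  dep_succ_of_eq := fun x h => by
    show (Function.update x μ (circSucc n M hM (x μ)) μ).2.val = 0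
    rw [Function.update_self]
    simp [circSucc, h]

end Torus

/-! ## §6d The a priori bound is automatic on finite lattices -/

section Apriori

variable {X₁ X₂ : Type} [Fintype X₁] [Fintype X₂] [DecidableEq X₁] {g : B6.Geometry}
  (blk₁ : X₁ → g.Site) (blk₂ : X₂ → g.Site)

/-- ON FINITE LATTICES EVERY LINEAR MAP HAS A CONSTANT MAJORANT between the sharp cube norms: `loc_y(Tμ) ≤ M₁·loc_{y′}(μ)` for `μ`
localised in the cube `y′`, with `M₁ = Σ_{x′} Σ_x |T(δ_x)(x′)|` — the a priori binder `hap` of `T4EtaRateDefect.idef_neumann_majorant` ∕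
`…N15.BackgroundStep.idef_background_propagator_majorant` is therefore automatic (with `T4EtaRateDefect.hasMaj_apriori_weighted` for a positive
weight). [folklore] -/
theorem exists_const_hasMaj_ofBlocks (T : (X₁ → ℝ) →ₗ[ℝ] (X₂ → ℝ)) :
    ∃ M₁ : ℝ, 0 ≤ M₁ ∧ HasMaj (BlockNorm.ofBlocks g blk₁) (BlockNorm.ofBlocks g blk₂) T (fun _ _ => M₁) := by
  classical
  refine ⟨∑ x', ∑ x, |T (Pi.single x 1) x'|,
    Finset.sum_nonneg fun _ _ => Finset.sum_nonneg fun _ _ => abs_nonneg _, ?_⟩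
  intro y' μ hμ y
  have hμ' : ∀ x : X₁, blk₁ x ≠ y' → μ x = 0 := hμ
  have hbd : ∀ x, |μ x| ≤ (BlockNorm.ofBlocks g blk₁).loc y' μ := by
    intro x
    by_cases hx : blk₁ x = y'
    · exact abs_le_loc_ofBlocks blk₁ μ hx
    · rw [hμ' x hx, abs_zero]
      exact (BlockNorm.ofBlocks g blk₁).loc_nonneg y' μ
  have hdec : μ = ∑ x, μ x • (Pi.single x (1 : ℝ) : X₁ → ℝ) := by
    funext z
    simp [Finset.sum_apply, Pi.single_apply]
  refine loc_ofBlocks_le blk₂ _ (mul_nonneg (Finset.sum_nonneg fun _ _ => Finset.sum_nonneg fun _ _ => abs_nonneg _)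
    ((BlockNorm.ofBlocks g blk₁).loc_nonneg y' μ)) fun x' _ => ?_
  have hTx : T μ x' = ∑ x, μ x * T (Pi.single x 1) x' := by
    conv_lhs => rw [hdec]
    simp [map_sum, Finset.sum_apply]
  rw [hTx]
  calc |∑ x, μ x * T (Pi.single x 1) x'| ≤ ∑ x, |μ x * T (Pi.single x 1) x'| := Finset.abs_sum_le_sum_abs _ _
    _ ≤ ∑ x, (BlockNorm.ofBlocks g blk₁).loc y' μ * |T (Pi.single x 1) x'| :=
        Finset.sum_le_sum fun x _ => by
          rw [abs_mul]
          exact mul_le_mul_of_nonneg_right (hbd x) (abs_nonneg _)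
    _ = (∑ x, |T (Pi.single x 1) x'|) * (BlockNorm.ofBlocks g blk₁).loc y' μ := by
        rw [Finset.sum_mul]
        exact Finset.sum_congr rfl fun x _ => mul_comm _ _
    _ ≤ (∑ x'', ∑ x, |T (Pi.single x 1) x''|) * (BlockNorm.ofBlocks g blk₁).loc y' μ :=
        mul_le_mul_of_nonneg_right
          (Finset.single_le_sum (f := fun x'' => ∑ x, |T (Pi.single x 1) x''|)
            (fun _ _ => Finset.sum_nonneg fun _ _ => abs_nonneg _) (Finset.mem_univ x'))
          ((BlockNorm.ofBlocks g blk₁).loc_nonneg y' μ)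

/-- … hence the SOURCE-WEIGHTED a priori bound `M₀·w(y′)` for any positive weight. [folklore] -/
theorem exists_apriori_weighted_ofBlocks (T : (X₁ → ℝ) →ₗ[ℝ] (X₂ → ℝ)) {w : g.Site → ℝ} (hw : ∀ y, 0 < w y) :
    ∃ M₀ : ℝ, 0 ≤ M₀ ∧ HasMaj (BlockNorm.ofBlocks g blk₁) (BlockNorm.ofBlocks g blk₂) T (fun _ y' => M₀ * w y') := by
  obtain ⟨M₁, hM₁, h⟩ := exists_const_hasMaj_ofBlocks blk₁ blk₂ T
  exact ⟨M₁ * ∑ y : g.Site, (w y)⁻¹,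
    mul_nonneg hM₁ (Finset.sum_nonneg fun y _ => (inv_pos.mpr (hw y)).le),
    T4EtaRateDefect.hasMaj_apriori_weighted hM₁ hw h⟩

end Apriori

/-! ## §7 Sharpness: the pointwise majorant `M − 1` is attained (one coarse point, two fine points) -/

section Toy

open T4EtaRateDefect (toyG)

/-- The circle with ONE coarse point and `M = 2` fine points. [folklore] -/
def toyLine : LineData (ZMod 1) (ZMod 1 × Fin 2) := circLine 1 2 Nat.two_pos

/-- The pointwise majorant `diagK (M − 1) = diagK 1` HOLDS for `M_χ ∘ pull π` (an instance of §5). [folklore] -/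
theorem toy_hasMaj :
    HasMaj (BlockNorm.ofBlocks toyG (fun _ : ZMod 1 => ())) (BlockNorm.ofBlocks toyG ((fun _ : ZMod 1 => ()) ∘ toyLine.π))
      (mulOp toyLine.chi ∘ₗ pull toyLine.π) (diagK fun _ => (1 : ℝ)) := by
  have h := hasMaj_mulOp_chi_pull (g := toyG) toyLine (fun _ : ZMod 1 => ())
  have hM : ((toyLine.M : ℕ) : ℝ) - 1 = 1 := by
    show ((2 : ℕ) : ℝ) - 1 = 1
    norm_num
  simpa only [hM] using h

/-- MUST-FAIL TWIN: `diagK (1/2)` is FALSE for the same operator — on the input `μ ≡ 1` the output is `χ = (−1, 1)`, of fine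
block sup `1 > 1/2`: the η-defect of the derivative is of ORDER ONE pointwise; only the composite statement of §5 is small.
[folklore] -/
theorem toy_not_hasMaj_half :
    ¬ HasMaj (BlockNorm.ofBlocks toyG (fun _ : ZMod 1 => ()))
        (BlockNorm.ofBlocks toyG ((fun _ : ZMod 1 => ()) ∘ toyLine.π))
        (mulOp toyLine.chi ∘ₗ pull toyLine.π) (diagK fun _ => (1 / 2 : ℝ)) := by
  intro hmaj
  have hloc : (BlockNorm.ofBlocks toyG (fun _ : ZMod 1 => ())).IsLoc () (fun _ : ZMod 1 => (1 : ℝ)) :=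
    fun x hx => absurd rfl hx
  have h := hmaj () (fun _ => (1 : ℝ)) hloc ()
  have hup : (BlockNorm.ofBlocks toyG (fun _ : ZMod 1 => ())).loc () (fun _ : ZMod 1 => (1 : ℝ)) ≤ 1 :=
    loc_ofBlocks_le _ _ zero_le_one fun _ _ => by simp
  -- the face point `(0, 1)` of the block carries `χ = M − 1 = 1`
  have hface : toyLine.chi ((0 : ZMod 1), (1 : Fin 2)) = 1 := by
    show (if (1 : Fin 2).val + 1 = 2 then ((2 : ℕ) : ℝ) - 1 else -1) = 1
    norm_num
  have hlow : (1 : ℝ) ≤ (BlockNorm.ofBlocks toyG ((fun _ : ZMod 1 => ()) ∘ toyLine.π)).loc ()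
      ((mulOp toyLine.chi ∘ₗ pull toyLine.π) (fun _ : ZMod 1 => (1 : ℝ))) := by
    have := abs_le_loc_ofBlocks (g := toyG) ((fun _ : ZMod 1 => ()) ∘ toyLine.π)
      ((mulOp toyLine.chi ∘ₗ pull toyLine.π) (fun _ : ZMod 1 => (1 : ℝ))) (x' := ((0 : ZMod 1), (1 : Fin 2)))
      (y := ()) rfl
    simpa [hface] using this
  rw [diagK_same] at h
  linarith

end Toy

end Summit.QuantumFields.YangMills.BalabanUVNodes.N15.DerivDefect
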